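import Summits.CriticalPhenomena.SAWScalingLimit.Theorems.MassRatio.Negative.FjordB

/-!
# Crux `MassRatio` (stmt-CriticalPhenomena-8550) — load-bearing hypotheses, part 9: the slab family `Λ₁` (rows family minus the slab `rows m..m+2 × pos ≤ -1`, plus staircase and a corridor to `b₁ → -i`): membership, simple connectivity, connectedness

Negative knowledge on the crux `MassRatio` (stmt-CriticalPhenomena-8550, route SAWDefectDecoherence r3),
written by the standing disprover (cdisprove, cycles 1–4). The series `MassRatio/Negative/*` does NOT
refute the crux (verdict: RESISTS — it is a pure exponent bet, predicted ratio `δ^{-25/48}` against the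
cut `δ^{-3/4}`); it proves which hypotheses of the crux are LOAD-BEARING (rows clause, `0 < ρ`,
`δ·mid(b_δ) → b`, exhaustion of compacts: each deleted ⇒ FALSE, by explicit admissible families in the
rectangle `D₀ = (-2,2)×(-1,1)` whose boundary mass at the target edge is starved EXACTLY by a bare
corridor), that the hypothesis frame is satisfiable (`massRatio_frame_nonvacuous`), and that the
`Nonempty`-SAW clause is implied by the others. Mechanism throughout: on a bare root-attached corridor
the self-avoiding walk is unique, so `|Z| = x_c^{length}` exactly, while a staircase walk certifies
`|Z(e₀)| ≥ x_c^{2 iK + 1}` at a mid-edge `e₀` of the compact `Kbox`; `x_c < 3/5` and Bernoulli finish.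
-/

namespace Summit.CriticalPhenomena.SAWScalingLimit.Theorems.MassRatio.Negative

open Literature.Probability.LatticeModels Literature.Probability.RandomPlanarGeometry.SAW
open Literature.Probability.RandomPlanarGeometry
open Summit.CriticalPhenomena.SAWScalingLimit.Theses.SAWDefectDecoherence

/-! ## §H. The slab family `Λ₁`: the hypothesis `δ·mid(b_δ) → b` is load-bearing

`Λ₁(δ)` = the full rows family `ΛR(δ)` (so the ROWS CLAUSE HOLDS in the unit ball about `b = 1 - i`)
minus the slab `{rows m … m+2} × {positions ≤ -1}` (physically a strip of height `3` rows along the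
left half of the bottom side, invisible to compacts), plus the staircase and a bare corridor along
row `m` from `(m, pA+1)` to `(m, -6)`; the marked mid-edge is the corridor tip
`b''_δ = {(m,-6),(m,-5)}`, which converges to `-i` instead of `b`. Everything else in the frame holds,
and the same mass comparison fails: `b_δ → b` is what pins `b_δ` to the protected flat piece. -/

/-- **The slab family** (filter of the big rectangle by a coordinate predicate). [folklore] -/
noncomputable def Λ₁ (δ : ℝ) : Finset HexVertex := by
  classical exact (Rect (mRow δ) (MRow δ) (-PPos δ) (PPos δ)).filter fun v =>
    (mRow δ ≤ row v ∧ row v ≤ MRow δ ∧ -PPos δ ≤ pos v ∧ pos v ≤ PPos δ ∧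
      ¬ (row v ≤ mRow δ + 2 ∧ pos v ≤ -1)) ∨
    (row v = mRow δ ∧ pA δ - 1 ≤ pos v ∧ pos v ≤ -6) ∨
    (row v = mRow δ + 1 ∧ (pos v = pA δ - 1 ∨ pos v = pA δ - 2)) ∨
    (row v = mRow δ + 2 ∧ (pos v = pA δ - 2 ∨ pos v = pA δ - 3))

/-- the corridor tip `b''_δ = {(m, -6), (m, -5)}` [folklore] -/
noncomputable def b₁ (δ : ℝ) : Sym2 HexVertex := s(bv (mRow δ) (-6), bv (mRow δ) (-5))

/-- corridor length of the slab family [folklore] -/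
noncomputable def L₁ (δ : ℝ) : ℕ := (-6 - pA δ).toNat

section SlabFamily

variable {δ : ℝ}

/-- `Λ₁_subset`: slab-family (`Λ₁`) lemma (MassRatio negative series). [folklore] -/
theorem Λ₁_subset (δ : ℝ) : Λ₁ δ ⊆ ΛR δ := by
  unfold Λ₁ ΛR; exact Finset.filter_subset _ _

/-- `bv_mem_Λ₁`: slab-family (`Λ₁`) lemma (MassRatio negative series). [folklore] -/
theorem bv_mem_Λ₁ (hδ : 0 < δ) (hδ1 : δ ≤ 1 / 100) {r p : ℤ} :
    bv r p ∈ Λ₁ δ ↔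
      (mRow δ ≤ r ∧ r ≤ MRow δ ∧ -PPos δ ≤ p ∧ p ≤ PPos δ ∧ ¬ (r ≤ mRow δ + 2 ∧ p ≤ -1)) ∨
      (r = mRow δ ∧ pA δ - 1 ≤ p ∧ p ≤ -6) ∨
      (r = mRow δ + 1 ∧ (p = pA δ - 1 ∨ p = pA δ - 2)) ∨
      (r = mRow δ + 2 ∧ (p = pA δ - 2 ∨ p = pA δ - 3)) := by
  obtain ⟨h1, h2, h3, h4, h5, h6, h7, h8, -⟩ := params hδ hδ1
  unfold Λ₁
  rw [Finset.mem_filter, bv_mem_Rect, row_bv, pos_bv]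
  constructor
  · exact fun h => h.2
  · intro h; refine ⟨?_, h⟩; omega

/-- `bv_mem_compl_Λ₁`: slab-family (`Λ₁`) lemma (MassRatio negative series). [folklore] -/
theorem bv_mem_compl_Λ₁ (hδ : 0 < δ) (hδ1 : δ ≤ 1 / 100) {r p : ℤ}
    (h : ¬ ((mRow δ ≤ r ∧ r ≤ MRow δ ∧ -PPos δ ≤ p ∧ p ≤ PPos δ ∧ ¬ (r ≤ mRow δ + 2 ∧ p ≤ -1)) ∨
      (r = mRow δ ∧ pA δ - 1 ≤ p ∧ p ≤ -6) ∨
      (r = mRow δ + 1 ∧ (p = pA δ - 1 ∨ p = pA δ - 2)) ∨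
      (r = mRow δ + 2 ∧ (p = pA δ - 2 ∨ p = pA δ - 3)))) :
    bv r p ∈ ((↑(Λ₁ δ) : Set HexVertex))ᶜ := by
  rw [Set.mem_compl_iff, Finset.mem_coe, bv_mem_Λ₁ hδ hδ1]; exact h

/-- The complement of `Λ₁` is connected (the pocket above the corridor drains through the gap
`{(m,-5),…,(m,-1)}`). [folklore] -/
theorem linked_compl_Λ₁ (hδ : 0 < δ) (hδ1 : δ ≤ 1 / 100) {v : HexVertex} (hv : v ∉ Λ₁ δ) :
    Linked ((↑(Λ₁ δ) : Set HexVertex))ᶜ v (bv (mRow δ - 1) (-PPos δ - 3)) := by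
  obtain ⟨hiM, hM0, hm10, hPa, hpa, hpb, hbP, hP100, -⟩ := params hδ hδ1
  set m := mRow δ with hm
  set M := MRow δ with hM
  set P := PPos δ with hP
  have hv' : v = bv (row v) (pos v) := (bv_row_pos v).symm
  set r := row v with hr
  set p := pos v with hp
  rw [hv'] at hv ⊢
  rw [bv_mem_Λ₁ hδ hδ1] at hv
  set C := ((↑(Λ₁ δ) : Set HexVertex))ᶜ with hC
  have nm : ∀ r' p' : ℤ, ¬ ((m ≤ r' ∧ r' ≤ M ∧ -P ≤ p' ∧ p' ≤ P ∧ ¬ (r' ≤ m + 2 ∧ p' ≤ -1)) ∨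
      (r' = m ∧ pA δ - 1 ≤ p' ∧ p' ≤ -6) ∨
      (r' = m + 1 ∧ (p' = pA δ - 1 ∨ p' = pA δ - 2)) ∨
      (r' = m + 2 ∧ (p' = pA δ - 2 ∨ p' = pA δ - 3))) → bv r' p' ∈ C :=
    fun r' p' h => bv_mem_compl_Λ₁ hδ hδ1 h
  have bandL : ∀ r' : ℤ, Linked C (bv r' (-P - 3)) (bv (m - 1) (-P - 3)) := by
    intro r'
    rcases le_or_gt r' (m - 1) with h | h
    · exact (linked_band (-P - 3) r' (m - 1) h fun r'' _ _ =>
        ⟨nm _ _ (by omega), by have := nm r'' (-P - 3 + 1) (by omega); exact this⟩).symm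
    · exact linked_band (-P - 3) (m - 1) r' h.le fun r'' _ _ =>
        ⟨nm _ _ (by omega), by have := nm r'' (-P - 3 + 1) (by omega); exact this⟩
  have routeL : ∀ r' p' : ℤ, (∀ t, min p' (-P - 3) ≤ t → t ≤ max p' (-P - 3) →
      bv r' t ∈ C) → Linked C (bv r' p') (bv (m - 1) (-P - 3)) := by
    intro r' p' hfree
    have step1 : Linked C (bv r' p') (bv r' (-P - 3)) := by
      rcases le_or_gt p' (-P - 3) with h | h
      · exact linked_run' r' p' (-P - 3) h fun t h1 h2 => hfree t (by omega) (by omega)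
      · exact (linked_run' r' (-P - 3) p' h.le fun t h1 h2 => hfree t (by omega) (by omega)).symm
    exact step1.trans (bandL r')
  have routeR : ∀ r' p' : ℤ, m - 1 ≤ r' → (∀ t, min p' (P + 2) ≤ t → t ≤ max p' (P + 2) →
      bv r' t ∈ C) → Linked C (bv r' p') (bv (m - 1) (-P - 3)) := by
    intro r' p' hr' hfree
    have step1 : Linked C (bv r' p') (bv r' (P + 2)) := by
      rcases le_or_gt p' (P + 2) with h | h
      · exact linked_run' r' p' (P + 2) h fun t h1 h2 => hfree t (by omega) (by omega)
      · exact (linked_run' r' (P + 2) p' h.le fun t h1 h2 => hfree t (by omega) (by omega)).symm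
    have step2 : Linked C (bv r' (P + 2)) (bv (m - 1) (P + 2)) :=
      linked_band (P + 2) (m - 1) r' hr' fun r'' _ _ =>
        ⟨nm _ _ (by omega), by have := nm r'' (P + 2 + 1) (by omega); exact this⟩
    have step3 : Linked C (bv (m - 1) (P + 2)) (bv (m - 1) (-P - 3)) :=
      (linked_run' (m - 1) (-P - 3) (P + 2) (by omega) fun t _ _ => nm _ _ (by omega)).symm
    exact (step1.trans step2).trans step3
  -- the gap route: along the row to position `-3`, down the band `{-3,-2}` to row `m-1`
  have routeG : ∀ r' p' : ℤ, m - 1 ≤ r' → r' ≤ m + 2 →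
      (∀ t, min p' (-3) ≤ t → t ≤ max p' (-3) → bv r' t ∈ C) →
      Linked C (bv r' p') (bv (m - 1) (-P - 3)) := by
    intro r' p' hr1 hr2 hfree
    have step1 : Linked C (bv r' p') (bv r' (-3)) := by
      rcases le_or_gt p' (-3) with h | h
      · exact linked_run' r' p' (-3) h fun t h1 h2 => hfree t (by omega) (by omega)
      · exact (linked_run' r' (-3) p' h.le fun t h1 h2 => hfree t (by omega) (by omega)).symm
    have step2 : Linked C (bv r' (-3)) (bv (m - 1) (-3)) :=
      linked_band (-3) (m - 1) r' hr1 fun r'' _ _ =>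
        ⟨nm _ _ (by omega), by have := nm r'' (-3 + 1) (by omega); exact this⟩
    have step3 : Linked C (bv (m - 1) (-3)) (bv (m - 1) (-P - 3)) :=
      (linked_run' (m - 1) (-P - 3) (-3) (by omega) fun t _ _ => nm _ _ (by omega)).symm
    exact (step1.trans step2).trans step3
  by_cases hfree : r ≤ m - 1 ∨ M + 1 ≤ r
  · exact routeL r p fun t _ _ => nm _ _ (by omega)
  by_cases hrm : r = m
  · by_cases hpl : p ≤ pA δ - 2
    · exact routeL r p fun t h1 h2 => nm _ _ (by omega)
    by_cases hpg : p ≤ -1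
    · exact routeG r p (by omega) (by omega) fun t h1 h2 => nm _ _ (by omega)
    · exact routeR r p (by omega) fun t h1 h2 => nm _ _ (by omega)
  by_cases hrm1 : r = m + 1
  · by_cases hpl : p ≤ pA δ - 3
    · exact routeL r p fun t h1 h2 => nm _ _ (by omega)
    by_cases hpg : p ≤ -1
    · exact routeG r p (by omega) (by omega) fun t h1 h2 => nm _ _ (by omega)
    · exact routeR r p (by omega) fun t h1 h2 => nm _ _ (by omega)
  by_cases hrm2 : r = m + 2
  · by_cases hpl : p ≤ pA δ - 4
    · exact routeL r p fun t h1 h2 => nm _ _ (by omega)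
    by_cases hpg : p ≤ -1
    · exact routeG r p (by omega) (by omega) fun t h1 h2 => nm _ _ (by omega)
    · exact routeR r p (by omega) fun t h1 h2 => nm _ _ (by omega)
  by_cases hpl : p < -P
  · exact routeL r p fun t h1 h2 => nm _ _ (by omega)
  · exact routeR r p (by omega) fun t h1 h2 => nm _ _ (by omega)

/-- `simplyConnected_Λ₁`: slab-family (`Λ₁`) lemma (MassRatio negative series). [folklore] -/
theorem simplyConnected_Λ₁ (hδ : 0 < δ) (hδ1 : δ ≤ 1 / 100) : hexDomainSimplyConnected (Λ₁ δ) :=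
  preconnected_of_linked fun _ hu _ hv =>
    (linked_compl_Λ₁ hδ hδ1 (fun h => hu h)).trans (linked_compl_Λ₁ hδ hδ1 (fun h => hv h)).symm

/-- `Λ₁` is connected. [folklore] -/
theorem linked_Λ₁ (hδ : 0 < δ) (hδ1 : δ ≤ 1 / 100) {v : HexVertex} (hv : v ∈ Λ₁ δ) :
    Linked (↑(Λ₁ δ) : Set HexVertex) v (bv (MRow δ) 0) := by
  obtain ⟨hiM, hM0, hm10, hPa, hpa, hpb, hbP, hP100, -⟩ := params hδ hδ1
  have hmod := pA_mod δ
  set m := mRow δ with hm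
  set M := MRow δ with hM
  set P := PPos δ with hP
  have hv' : v = bv (row v) (pos v) := (bv_row_pos v).symm
  set r := row v
  set p := pos v
  rw [hv'] at hv ⊢
  rw [bv_mem_Λ₁ hδ hδ1] at hv
  set C := (↑(Λ₁ δ) : Set HexVertex) with hC
  have mm : ∀ r' p' : ℤ, ((m ≤ r' ∧ r' ≤ M ∧ -P ≤ p' ∧ p' ≤ P ∧ ¬ (r' ≤ m + 2 ∧ p' ≤ -1)) ∨
      (r' = m ∧ pA δ - 1 ≤ p' ∧ p' ≤ -6) ∨
      (r' = m + 1 ∧ (p' = pA δ - 1 ∨ p' = pA δ - 2)) ∨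
      (r' = m + 2 ∧ (p' = pA δ - 2 ∨ p' = pA δ - 3))) → bv r' p' ∈ C := fun r' p' h => by
    rw [hC, Finset.mem_coe, bv_mem_Λ₁ hδ hδ1]; exact h
  have bulk : ∀ r' p' : ℤ, m ≤ r' → r' ≤ M → -P ≤ p' → p' ≤ P → ¬ (r' ≤ m + 2 ∧ p' ≤ -1) →
      Linked C (bv r' p') (bv M 0) := by
    intro r' p' h1 h2 h3 h4 h5
    have step1 : Linked C (bv r' p') (bv r' 0) := by
      rcases le_or_gt p' 0 with h | h
      · exact linked_run' r' p' 0 h fun t _ _ => mm _ _ (by omega)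
      · exact (linked_run' r' 0 p' h.le fun t _ _ => mm _ _ (by omega)).symm
    exact step1.trans (linked_band 0 r' M h2 fun r'' _ _ => ⟨mm _ _ (by omega), mm _ _ (by omega)⟩).symm
  have a1 : Linked C (bv m (pA δ - 1)) (bv (m + 1) (pA δ - 1)) :=
    linked_of_adj (mm _ _ (by omega)) (mm _ _ (by omega))
      (by rw [adj_bv_iff]; right; right; exact ⟨rfl, rfl, by omega⟩)
  have a2 : Linked C (bv (m + 1) (pA δ - 1)) (bv (m + 1) (pA δ - 2)) :=
    linked_of_adj (mm _ _ (by omega)) (mm _ _ (by omega))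
      (by rw [adj_bv_iff]; left; exact ⟨rfl, Or.inr (by ring)⟩)
  have a3 : Linked C (bv (m + 1) (pA δ - 2)) (bv (m + 2) (pA δ - 2)) :=
    linked_of_adj (mm _ _ (by omega)) (mm _ _ (by omega))
      (by rw [adj_bv_iff]; right; right; exact ⟨rfl, by ring, by omega⟩)
  have a4 : Linked C (bv (m + 2) (pA δ - 2)) (bv (m + 2) (pA δ - 3)) :=
    linked_of_adj (mm _ _ (by omega)) (mm _ _ (by omega))
      (by rw [adj_bv_iff]; left; exact ⟨rfl, Or.inr (by ring)⟩)
  have a5 : Linked C (bv (m + 2) (pA δ - 3)) (bv (m + 3) (pA δ - 3)) :=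
    linked_of_adj (mm _ _ (by omega)) (mm _ _ (by omega))
      (by rw [adj_bv_iff]; right; right; exact ⟨rfl, by ring, by omega⟩)
  have top : Linked C (bv (m + 3) (pA δ - 3)) (bv M 0) :=
    bulk _ _ (by omega) (by omega) (by omega) (by omega) (by omega)
  have s5 := a5.trans top
  have s4 := a4.trans s5
  have s3 := a3.trans s4
  have s2 := a2.trans s3
  have s1 := a1.trans s2
  rcases hv with h | ⟨hr, hp1, hp2⟩ | ⟨hr, hp | hp⟩ | ⟨hr, hp | hp⟩
  · exact bulk r p h.1 h.2.1 h.2.2.1 h.2.2.2.1 h.2.2.2.2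
  · have run : Linked C (bv r p) (bv m (pA δ - 1)) := by
      rw [hr]
      exact (linked_run' m (pA δ - 1) p hp1 fun t _ _ => mm _ _ (by omega)).symm
    exact run.trans s1
  · rw [hr, hp]; exact s2
  · rw [hr, hp]; exact s3
  · rw [hr, hp]; exact s4
  · rw [hr, hp]; exact s5

/-- `preconnected_Λ₁`: slab-family (`Λ₁`) lemma (MassRatio negative series). [folklore] -/
theorem preconnected_Λ₁ (hδ : 0 < δ) (hδ1 : δ ≤ 1 / 100) :
    (hexGraph.induce ((Λ₁ δ : Finset HexVertex) : Set HexVertex)).Preconnected :=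
  preconnected_of_linked fun _ hu _ hv =>
    (linked_Λ₁ hδ hδ1 hu).trans (linked_Λ₁ hδ hδ1 hv).symm

end SlabFamily

end Summit.CriticalPhenomena.SAWScalingLimit.Theorems.MassRatio.Negative
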